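import Summits.CriticalPhenomena.PercolationContinuityZ3.Theorems.Transplant.KNCellsCoverO
import Summits.CriticalPhenomena.PercolationContinuityZ3.Theorems.Transplant.KNCellsCover
import Literature.Probability.Percolation.KozmaNitzanTheorem6
import Summits.CriticalPhenomena.PercolationContinuityZ3.Theorems.Transplant.KNCellsSchemeO
import Summits.CriticalPhenomena.PercolationContinuityZ3.Theorems.Transplant.KNCellsProcessO
import Summits.CriticalPhenomena.PercolationContinuityZ3.Theorems.Transplant.KNCellsRunO
import Summits.CriticalPhenomena.PercolationContinuityZ3.Theorems.Transplant.KNCellsRunInvO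
import Summits.CriticalPhenomena.PercolationContinuityZ3.Theorems.Transplant.KNCellsReach
import Literature.Probability.Percolation.OrientedHistorySiteRenormalizationRun
import HarnessLib

/-!
# N2 (frames-only node `SamePDropOfSkeletonFrm₁`, OPEN) — ORIENTED MACRO LAYER (WAVE 0 (c1), (R-18) `q ≡ true`): the oriented twin of N1's `KNCellsReach`

builds on p205010 (kernel theorem, internal audit signed; external expert review pending) — nothing in this file uses p205010; NOTHING is claimed about the
open node `SamePDropOfSkeletonFrm₁` (`SamePDropOfSkeletonNeg₁` is CLOSED in the tree and untouched by this file).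
Status sentence (coordinator 2026-08-20T04:30Z): "θ(p_c) = 0 on ℤ^d, all d ≥ 2 — kernel-verified (Lean 4/Mathlib, standard axioms); internal adversarial
audit SIGNED 2026-08-20 04:29Z; external expert review pending."
Lane `prim-bschramm-*`, seat `prim-bschramm-stmt` (gen 19); helper file (`--supports stmt-CriticalPhenomena-4575 --as helper`); N2-SCOPE §20, (R-18)/(R-19).
PORT RULES (HOME/prim-bschramm-stmt-g19/lean/port_orient.py): the history-site API is replaced by its ORIENTED twin at the fixed quadrant `qNE := fun _ => true`
(`HState.choice ↦ HState.ochoice qNE`, `mstOf ↦ omstOf qNE`, `mst/stN ↦ omst/ostN qNE`, `occFinal ↦ ooccFinal qNE`, `Lawful ↦ OLawful qNE`, onward directions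
`onward ↦ onwardO` = the POSITIVE ones, (N2-e)); every declaration whose text changes thereby — directly or through a changed declaration — is re-declared with the
suffix `O` (same namespace); unchanged declarations of the N1 file are NOT repeated (the N1 module is imported). Docstrings/citations are N1's.
N1 HEADER (kept for the reader):
* `pinW_F_ξ_eq`, `real_W₀_eq` — the recorded pattern is `ω ∪ U₀` on the explored edges; `P[W₀](root ↔ M_v) = P[pinned](root ↔ M_v inside
  E_i ∪ E_{w,v})`;
* **`reach_of_probe`** — (32) for `w ≠ root cell`: if `w = tgt e₀` was examined at time `m < n` (departure anchor `a'` read off the observation)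
  and its connection to the still undetermined `x = w + du` was good at level `j_x`, then at time `n` (where `w`'s departure anchor is still
  `a'`) `P(root ↔ M^{a'}_x in E_n ∪ E^{a'}_{w,x} | ω|_{E_n}) > 1 - δ` — KN p. 28 with (31) (`mem_Stub_of_mem_V_of_mem_Efar`);
* **`reach_root`** — (32) at the root cell from the hypothesis `hQ0` (the choice of the scale, KN p. 28 "definition of `m₂`");
* **`valid_of_choice`** — every history of the run at which an edge is chosen is `Valid` ((29) both halves, the anchored cover, (32));
* **`lawful`** — the scheme is `Lawful G p ε` given `hQ0` and the failure bound (33) after valid histories (`hfail`, from the Steps files).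
[cite: KozmaNitzan2024, §4 pp. 26–31 ((29), (31), (32), Step I) — the ℤ^d model] [cite: GrimmettPercolation1999, §7.2]
-/
noncomputable section

open MeasureTheory ProbabilityTheory
open scoped ENNReal Classical

namespace Summit.CriticalPhenomena.PercolationContinuityZ3.Theorems

namespace Transplant

namespace KNCells

open Literature.Probability.Percolation Literature.Probability.LatticeModels SimpleGraph GadgetSystem ProbeHistory HSiteScheme Contour
open Literature.Probability.Percolation.KozmaNitzan (KSch.pinW_apply_eq_of_mem)

variable {V : Type*} [DecidableEq V] [Countable V]

namespace KSchA

variable {A : Type*} {G : SimpleGraph V} [G.LocallyFinite] {S : KSchA V A}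
variable (hΓ : RunGeom G S.Γ) (hsep : SepGeom G S.Γ) {ω : BondConfig V}
include hΓ hsep

omit [Countable V] hsep in
/-- The recorded pattern is `ω ∪ U₀` on the explored edges: the two pinnings agree. [folklore] -/
theorem pinW_F_ξ_eqO (n : ℕ) :
    pinW (KNLevels.lattW G S.p) ↑(S.F G (S.hstO G ω n)) ↑(S.ξ G (S.hstO G ω n)) =
      pinW (KNLevels.lattW G S.p) ↑(S.F G (S.hstO G ω n)) (ω ∪ ↑(S.U₀ G)) := by
  refine pinW_congr _ fun x hx => ?_
  rw [Finset.mem_coe, (runInvO hΓ ω n).ξ_iff x, Set.mem_union, Finset.mem_coe]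
  exact ⟨fun h => h.2, fun h => ⟨Finset.mem_coe.1 hx, h⟩⟩

/-- `P[W₀](root ↔ M_v) = P[pinned on ω ∪ U₀](root ↔ M_v in E_i ∪ E_{w,v})` (any anchors). [cite: KozmaNitzan2024, §4 p. 28 ((32))] -/
theorem real_W₀_eqO (n : ℕ) (e : Site 2 × MDir) (a b : A) :
    (prodBernoulli (S.W₀ G (S.hstO G ω n) e a)).real (⋃ t ∈ S.Γ.M b (tgt e), openConn S.Γ.root t) =
      (prodBernoulli (pinW (KNLevels.lattW G S.p) ↑(S.F G (S.hstO G ω n)) (ω ∪ ↑(S.U₀ G)))).real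
        (⋃ t ∈ (↑(S.Γ.M b (tgt e)) : Set V), openConnIn (↑(S.Vx G (S.hstO G ω n) ∪ S.Γ.Ewv a e.1 e.2) : Set V) S.Γ.root t) := by
  have h0 : S.Γ.root ∈ (↑(S.Vx G (S.hstO G ω n) ∪ S.Γ.Ewv a e.1 e.2) : Set V) :=
    Finset.mem_coe.2 (Finset.mem_union_left _ (root_mem_VO hΓ hsep.root_mem n))
  rw [W₀, ← Finset.set_biUnion_coe, prodBernoulli_restrW_real_biUnion_openConn _ _ h0, pinW_F_ξ_eqO hΓ]

/-- **(32) away from the root cell** (KN p. 28 and Step I): if `w = tgt e` was examined at time `m < n` and its connection to the still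
undetermined `x = w + du` was good at level `j_x` (departure anchor and level read off the observation), then
`P(root ↔ M_x in E_n ∪ E_{w,x} | ω|_{E_n}) > 1 - δ`, everything at `w`'s (frozen) departure anchor. [cite: KozmaNitzan2024, §4 p. 28 ((32) for w ≠ 0)] -/
theorem reach_of_probeO {n m : ℕ} (hm : m < n) {e : Site 2 × MDir}
    (hc : ((S.schemeO G).ostN qNE m ω).ochoice qNE = some e) (hV : S.ValidO G (S.hstO G ω m) e)
    (hD : (S.schemeO G).E.next (S.hstO G ω m) = some (S.probeO G (S.hstO G ω m) e (S.aOfO G (S.hstO G ω m) e))) {du : MDir}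
    (hv : ¬((S.schemeO G).ostN qNE n ω).Det (tgt e + stepVec du)) (hfwd : du.2 = qNE du.1)
    (hcond : S.cond G (S.hstO G ω m) e (S.aOfO G (S.hstO G ω m) e) (S.dOfO G ω (S.hstO G ω m) e) du
      (S.jOf G (S.hstO G ω m) e (S.aOfO G (S.hstO G ω m) e) (S.dOfO G ω (S.hstO G ω m) e) du (S.oOfO G ω (S.hstO G ω m) e))
      (S.oOfO G ω (S.hstO G ω m) e)) :
    1 - S.δc < (prodBernoulli (S.W₀ G (S.hstO G ω n) (tgt e, du) (S.dOfO G ω (S.hstO G ω m) e))).real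
      (⋃ t ∈ S.Γ.M (S.dOfO G ω (S.hstO G ω m) e) (tgt (tgt e, du)), openConn S.Γ.root t) := by
  set hm_ := S.hstO G ω m with hhm
  set a := S.aOfO G hm_ e with hadef
  set o := S.oOfO G ω hm_ e with ho
  set a' := S.dOfO G ω hm_ e with ha'def
  set j := S.jOf G hm_ e a a' du o with hjdef
  have hI := runInvO hΓ ω n
  have hIm := runInvO hΓ ω m
  have hdu : du ∈ S.onwardO G hm_ (tgt e) := Finset.mem_filter.2 ⟨mem_onward_of_not_detO hΓ hsep hm.le hv, hfwd⟩
  have hjK : j < S.Γ.K := S.jOf_lt _ _ _ _ _ _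
  have ha' : a' ∈ S.Γ.anchSet a (tgt e) := S.Γ.anchor_mem _ _ _
  -- `Fj_m ⊆ F_n`
  have hF1 : S.F G (S.hstO G ω (m + 1)) = S.F G hm_ ∪ S.revealOfO G hm_ e a o := (S.step_someO hc hD).1
  have hFjF : S.Fj G hm_ e a a' du j ⊆ S.F G (S.hstO G ω n) := by
    intro x hx
    by_cases hxF : x ∈ S.F G hm_
    · exact S.F_monoO ω hm.le hxF
    · have h1 : x ∈ S.revealOfO G hm_ e a o := S.Fj_sdiff_subset_revealOfO hdu le_rfl (Finset.mem_sdiff.2 ⟨hx, hxF⟩)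
      refine S.F_monoO ω (Nat.succ_le_of_lt hm) ?_
      show x ∈ S.F G (S.hstO G ω (m + 1))
      rw [hF1]; exact Finset.mem_union_right _ h1
  -- `F_n ∩ wireSet(Sx_m) ⊆ Fj_m` ((31))
  have hkey : ∀ x ∈ S.F G (S.hstO G ω n), x ∈ wireSet (↑(S.Sx G hm_ e a a' du) : Set V) → x ∈ S.Fj G hm_ e a a' du j := by
    intro x hx hxS
    rw [hI.F_eq, mem_edgesIn_iff] at hx
    rw [Fj, mem_edgesIn_iff]
    refine ⟨hx.1, fun y hy => ?_⟩
    have hyV := hx.2 y hy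
    have hyS := Finset.mem_coe.1 (hxS.1 y hy)
    rcases Finset.mem_union.1 hyS with hyS | hyS
    · exact Finset.mem_union_left _ hyS
    · exact Finset.mem_union_right _ (mem_Stub_of_mem_V_of_mem_EfarO hΓ hsep hm hc hV hD hv hfwd hyV hyS)
  -- the weights agree on `wireSet(Sx_m)`
  have hpq : ∀ x ∈ wireSet (↑(S.Sx G hm_ e a a' du) : Set V),
      pinW (KNLevels.lattW G S.p) ↑(S.Fj G hm_ e a a' du j) ↑(S.pat G hm_ e a a' du j o) x =
        pinW (KNLevels.lattW G S.p) ↑(S.F G (S.hstO G ω n)) (ω ∪ ↑(S.U₀ G)) x := by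
    intro x hxS
    by_cases hxj : x ∈ S.Fj G hm_ e a a' du j
    · refine KSch.pinW_apply_eq_of_mem _ (Finset.mem_coe.2 hxj) (Finset.mem_coe.2 (hFjF hxj)) ?_
      rw [Finset.mem_coe, pat, Finset.mem_union, Finset.mem_inter, Finset.mem_sdiff, ho, mem_obs_iff, Set.mem_union,
        Finset.mem_coe]
      by_cases hxF : x ∈ S.F G hm_
      · rw [hIm.ξ_iff x]
        constructor
        · rintro (⟨-, h'⟩ | ⟨-, -, h'⟩)
          · exact h'
          · exact absurd hxF h'
        · intro h'; exact Or.inl ⟨hxF, h'⟩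
      · have hxenv : x ∈ S.envO G hm_ e a := S.Fj_sdiff_subset_envO hm_ e a ha' hdu hjK (Finset.mem_sdiff.2 ⟨hxj, hxF⟩)
        have hxU : x ∉ S.U₀ G := fun h' => hxF (S.U₀_subset_F _ h')
        constructor
        · rintro (h' | ⟨⟨-, h'⟩, -, -⟩)
          · exact absurd (hV.ξ_sub h') hxF
          · exact Or.inl h'
        · rintro (h' | h')
          · exact Or.inr ⟨⟨hxenv, h'⟩, hxj, hxF⟩
          · exact absurd h' hxU
    · have hxF : x ∉ S.F G (S.hstO G ω n) := fun h' => hxj (hkey x h' hxS)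
      rw [pinW_apply_of_not_mem _ _ (fun h' => hxj (Finset.mem_coe.1 h')),
        pinW_apply_of_not_mem _ _ (fun h' => hxF (Finset.mem_coe.1 h'))]
  -- `Sx_m ⊆ E_n ∪ E_{w,x}`
  have hSx : (↑(S.Sx G hm_ e a a' du) : Set V) ⊆ ↑(S.Vx G (S.hstO G ω n) ∪ S.Γ.Ewv a' (tgt e) du) := by
    refine Finset.coe_subset.2 fun y hy => ?_
    rcases Finset.mem_union.1 hy with hy | hy
    · rcases Finset.mem_union.1 hy with hy | hy
      · exact Finset.mem_union_left _ (S.V_monoO ω hm.le hy)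
      · exact Finset.mem_union_left _ (newRegion_subset_VO hΓ hm hc hD (Finset.mem_union_left _ hy))
    · exact Finset.mem_union_right _ (hsep.Efar_subset_Btw_union_Q _ _ _ hy)
  have h0S : S.Γ.root ∈ (↑(S.Sx G hm_ e a a' du) : Set V) :=
    Finset.mem_coe.2 (Finset.mem_union_left _ (Finset.mem_union_left _ hV.root_mem))
  -- the chain
  have e1 : (prodBernoulli (S.Wt G hm_ e a a' du j o)).real (S.Conn a' e du) =
      (prodBernoulli (pinW (KNLevels.lattW G S.p) ↑(S.Fj G hm_ e a a' du j) ↑(S.pat G hm_ e a a' du j o))).real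
        (⋃ t ∈ (↑(S.Γ.M a' (tgt e + stepVec du)) : Set V), openConnIn (↑(S.Sx G hm_ e a a' du) : Set V) S.Γ.root t) := by
    rw [Conn, Wt, ← Finset.set_biUnion_coe, prodBernoulli_restrW_real_biUnion_openConn _ _ h0S]
  have e2 : (prodBernoulli (pinW (KNLevels.lattW G S.p) ↑(S.Fj G hm_ e a a' du j) ↑(S.pat G hm_ e a a' du j o))).real
        (⋃ t ∈ (↑(S.Γ.M a' (tgt e + stepVec du)) : Set V), openConnIn (↑(S.Sx G hm_ e a a' du) : Set V) S.Γ.root t) =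
      (prodBernoulli (pinW (KNLevels.lattW G S.p) ↑(S.F G (S.hstO G ω n)) (ω ∪ ↑(S.U₀ G)))).real
        (⋃ t ∈ (↑(S.Γ.M a' (tgt e + stepVec du)) : Set V), openConnIn (↑(S.Sx G hm_ e a a' du) : Set V) S.Γ.root t) :=
    prodBernoulli_real_eq_of_determinedBy _ _ hpq (determinedBy_biUnion_openConnIn _ _ _ subset_rfl)
      (measurableSet_biUnion_openConnIn _ _ _)
  have e3 : (prodBernoulli (pinW (KNLevels.lattW G S.p) ↑(S.F G (S.hstO G ω n)) (ω ∪ ↑(S.U₀ G)))).real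
        (⋃ t ∈ (↑(S.Γ.M a' (tgt e + stepVec du)) : Set V), openConnIn (↑(S.Sx G hm_ e a a' du) : Set V) S.Γ.root t) ≤
      (prodBernoulli (pinW (KNLevels.lattW G S.p) ↑(S.F G (S.hstO G ω n)) (ω ∪ ↑(S.U₀ G)))).real
        (⋃ t ∈ (↑(S.Γ.M a' (tgt e + stepVec du)) : Set V),
          openConnIn (↑(S.Vx G (S.hstO G ω n) ∪ S.Γ.Ewv a' (tgt e) du) : Set V) S.Γ.root t) :=
    measureReal_mono (biUnion_openConnIn_mono hSx _ subset_rfl) (measure_ne_top _ _)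
  have hc' : 1 - S.δc < (prodBernoulli (S.Wt G hm_ e a a' du j o)).real (S.Conn a' e du) := hcond
  rw [real_W₀_eqO hΓ hsep]
  change 1 - S.δc < (prodBernoulli (pinW (KNLevels.lattW G S.p) ↑(S.F G (S.hstO G ω n)) (ω ∪ ↑(S.U₀ G)))).real
    (⋃ t ∈ (↑(S.Γ.M a' (tgt e + stepVec du)) : Set V),
      openConnIn (↑(S.Vx G (S.hstO G ω n) ∪ S.Γ.Ewv a' (tgt e) du) : Set V) S.Γ.root t)
  rw [e1, e2] at hc'
  exact lt_of_lt_of_le hc' e3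

/-- **(32) at the root cell** (KN p. 28): the root cube is wired open, and by the choice of the scale (`hQ0`, "the definition of `m₂`")
`M^{a₀}_0` is joined to `M^{a₀}_x` inside `Q_0 ∪ E_{0,x}` with probability `> 1 - δ`. [cite: KozmaNitzan2024, §4 p. 28 ((32) for w = 0)] -/
theorem reach_rootO {n : ℕ} {du : MDir} (hv : ¬((S.schemeO G).ostN qNE n ω).Det ((0 : Site 2) + stepVec du))
    (hQ0 : 1 - S.δc < (prodBernoulli (pinW (KNLevels.lattW G S.p) ↑(S.U₀ G) ↑(S.U₀ G))).real
      (⋃ t ∈ (↑(S.Γ.M S.Γ.a₀ ((0 : Site 2) + stepVec du)) : Set V),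
        openConnIn (↑(S.Γ.Q S.Γ.a₀ 0 ∪ S.Γ.Ewv S.Γ.a₀ 0 du) : Set V) S.Γ.root t)) :
    1 - S.δc < (prodBernoulli (S.W₀ G (S.hstO G ω n) ((0 : Site 2), du) S.Γ.a₀)).real
      (⋃ t ∈ S.Γ.M S.Γ.a₀ (tgt ((0 : Site 2), du)), openConn S.Γ.root t) := by
  have hI := runInvO hΓ ω n
  have hQ0V : S.Γ.Q S.Γ.a₀ 0 ⊆ S.Vx G (S.hstO G ω n) := by
    have := hI.det_Q 0 (Or.inl (zero_mem_occO n)); rwa [hI.arr_zero] at this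
  -- `F_n ∩ wireSet(Q_0 ∪ E_{0,x}) ⊆ U₀`
  have hkey : ∀ x ∈ S.F G (S.hstO G ω n), x ∈ wireSet (↑(S.Γ.Q S.Γ.a₀ 0 ∪ S.Γ.Ewv S.Γ.a₀ 0 du) : Set V) → x ∈ S.U₀ G := by
    intro x hx hxS
    rw [hI.F_eq, mem_edgesIn_iff] at hx
    rw [U₀, mem_edgesIn_iff]
    refine ⟨hx.1, fun y hy => ?_⟩
    rcases Finset.mem_union.1 (Finset.mem_coe.1 (hxS.1 y hy)) with h | h
    · exact h
    · exact absurd h (not_mem_Ewv_root_of_mem_VO hΓ hsep hv (hx.2 y hy))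
  have hpq : ∀ x ∈ wireSet (↑(S.Γ.Q S.Γ.a₀ 0 ∪ S.Γ.Ewv S.Γ.a₀ 0 du) : Set V),
      pinW (KNLevels.lattW G S.p) ↑(S.U₀ G) ↑(S.U₀ G) x =
        pinW (KNLevels.lattW G S.p) ↑(S.F G (S.hstO G ω n)) (ω ∪ ↑(S.U₀ G)) x := by
    intro x hxS
    by_cases hxF : x ∈ S.F G (S.hstO G ω n)
    · have hxU : x ∈ S.U₀ G := hkey x hxF hxS
      refine KSch.pinW_apply_eq_of_mem _ (Finset.mem_coe.2 hxU) (Finset.mem_coe.2 hxF) ?_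
      simp only [Finset.mem_coe, Set.mem_union, hxU, or_true]
    · have hxU : x ∉ S.U₀ G := fun h' => hxF (S.U₀_subset_F _ h')
      rw [pinW_apply_of_not_mem _ _ (fun h' => hxU (Finset.mem_coe.1 h')),
        pinW_apply_of_not_mem _ _ (fun h' => hxF (Finset.mem_coe.1 h'))]
  have hsub : (↑(S.Γ.Q S.Γ.a₀ 0 ∪ S.Γ.Ewv S.Γ.a₀ 0 du) : Set V) ⊆ ↑(S.Vx G (S.hstO G ω n) ∪ S.Γ.Ewv S.Γ.a₀ 0 du) :=
    Finset.coe_subset.2 (Finset.union_subset_union hQ0V le_rfl)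
  have e2 : (prodBernoulli (pinW (KNLevels.lattW G S.p) ↑(S.U₀ G) ↑(S.U₀ G))).real
        (⋃ t ∈ (↑(S.Γ.M S.Γ.a₀ ((0 : Site 2) + stepVec du)) : Set V),
          openConnIn (↑(S.Γ.Q S.Γ.a₀ 0 ∪ S.Γ.Ewv S.Γ.a₀ 0 du) : Set V) S.Γ.root t) =
      (prodBernoulli (pinW (KNLevels.lattW G S.p) ↑(S.F G (S.hstO G ω n)) (ω ∪ ↑(S.U₀ G)))).real
        (⋃ t ∈ (↑(S.Γ.M S.Γ.a₀ ((0 : Site 2) + stepVec du)) : Set V),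
          openConnIn (↑(S.Γ.Q S.Γ.a₀ 0 ∪ S.Γ.Ewv S.Γ.a₀ 0 du) : Set V) S.Γ.root t) :=
    prodBernoulli_real_eq_of_determinedBy _ _ hpq (determinedBy_biUnion_openConnIn _ _ _ subset_rfl)
      (measurableSet_biUnion_openConnIn _ _ _)
  have e3 : (prodBernoulli (pinW (KNLevels.lattW G S.p) ↑(S.F G (S.hstO G ω n)) (ω ∪ ↑(S.U₀ G)))).real
        (⋃ t ∈ (↑(S.Γ.M S.Γ.a₀ ((0 : Site 2) + stepVec du)) : Set V),
          openConnIn (↑(S.Γ.Q S.Γ.a₀ 0 ∪ S.Γ.Ewv S.Γ.a₀ 0 du) : Set V) S.Γ.root t) ≤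
      (prodBernoulli (pinW (KNLevels.lattW G S.p) ↑(S.F G (S.hstO G ω n)) (ω ∪ ↑(S.U₀ G)))).real
        (⋃ t ∈ (↑(S.Γ.M S.Γ.a₀ ((0 : Site 2) + stepVec du)) : Set V),
          openConnIn (↑(S.Vx G (S.hstO G ω n) ∪ S.Γ.Ewv S.Γ.a₀ 0 du) : Set V) S.Γ.root t) :=
    measureReal_mono (biUnion_openConnIn_mono hsub _ subset_rfl) (measure_ne_top _ _)
  rw [real_W₀_eqO hΓ hsep]
  rw [e2] at hQ0
  exact lt_of_lt_of_le hQ0 e3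

omit [Countable V] hΓ hsep in
/-- Along the run the root's departure anchor is the root anchor. [folklore] -/
theorem dep_zeroO (n : ℕ) : (S.astOfO G (S.hstO G ω n)).dep 0 = S.Γ.a₀ := by
  have h0 : ((S.schemeO G).ostN qNE 0 ω).Det 0 := Or.inl (zero_mem_occO 0)
  exact (S.anchors_eq_of_detO h0 (Nat.zero_le n)).2

/-- **Every history of the run at which an edge is chosen is valid** ((29) both halves, the anchored cover, and (32)).
[cite: KozmaNitzan2024, §4 pp. 26–28 ((29), (31), (32))] -/
theorem valid_of_choiceO
    (hQ0 : ∀ du : MDir, du.2 = qNE du.1 → 1 - S.δc < (prodBernoulli (pinW (KNLevels.lattW G S.p) ↑(S.U₀ G) ↑(S.U₀ G))).real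
      (⋃ t ∈ (↑(S.Γ.M S.Γ.a₀ ((0 : Site 2) + stepVec du)) : Set V),
        openConnIn (↑(S.Γ.Q S.Γ.a₀ 0 ∪ S.Γ.Ewv S.Γ.a₀ 0 du) : Set V) S.Γ.root t))
    {n : ℕ} {e : Site 2 × MDir} (hc : ((S.schemeO G).ostN qNE n ω).ochoice qNE = some e) : S.ValidO G (S.hstO G ω n) e := by
  have hI := runInvO hΓ ω n
  obtain ⟨he1, he2⟩ := HState.cand_of_ochoice hc
  refine ⟨hI.F_eq, fun x hx => ((hI.ξ_iff x).1 hx).1, root_mem_VO hΓ hsep.root_mem n, col_of_detO hΓ hsep (Or.inl he1), ?_, ?_⟩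
  · refine ⟨{x | ((S.schemeO G).ostN qNE n ω).Det x}, he2, fun du hdu hdet => ?_, V_subset_CoverO hΓ hsep n⟩
    obtain ⟨y, hy, hyc⟩ := col_of_detO hΓ hsep hdet
    exact (Finset.mem_filter.1 (Finset.mem_filter.1 hdu).1).2 y hy hyc
  · obtain ⟨w, du⟩ := e
    rcases (S.schemeO G).exists_probe_of_det_oriented qNE ω n w (Or.inl he1) with hw0 | ⟨m, hm, e₀, P, hc₀, ht₀, hP, hocc⟩
    · subst hw0
      show 1 - S.δc < (prodBernoulli (S.W₀ G (S.hstO G ω n) ((0 : Site 2), du) ((S.astOfO G (S.hstO G ω n)).dep 0))).real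
        (⋃ t ∈ S.Γ.M ((S.astOfO G (S.hstO G ω n)).dep 0) (tgt ((0 : Site 2), du)), openConn S.Γ.root t)
      rw [dep_zeroO]
      exact reach_rootO hΓ hsep he2 (hQ0 du (HState.ocand_of_ochoice hc).2)
    · obtain ⟨e₁, hc₁, hV₀, rfl⟩ := S.of_next_someO hP
      rw [hc₀] at hc₁
      cases Option.some_injective _ hc₁
      subst ht₀
      have hsucc : S.succAO G (S.hstO G ω m) e₀ (S.aOfO G (S.hstO G ω m) e₀) (S.oOfO G ω (S.hstO G ω m) e₀) :=
        (S.succA_read_iffO _ _ _ _).1 (hocc.1 he1)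
      have hdu : du ∈ S.onwardO G (S.hstO G ω m) (tgt e₀) :=
        Finset.mem_filter.2 ⟨mem_onward_of_not_detO hΓ hsep hm.le he2, (HState.ocand_of_ochoice hc).2⟩
      have hdep : (S.astOfO G (S.hstO G ω n)).dep (tgt e₀) = S.dOfO G ω (S.hstO G ω m) e₀ := (anchors_tgt_of_probeO hm hc₀ hP).2
      show 1 - S.δc < (prodBernoulli (S.W₀ G (S.hstO G ω n) (tgt e₀, du) ((S.astOfO G (S.hstO G ω n)).dep (tgt e₀)))).real
        (⋃ t ∈ S.Γ.M ((S.astOfO G (S.hstO G ω n)).dep (tgt e₀)) (tgt (tgt e₀, du)), openConn S.Γ.root t)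
      rw [hdep]
      exact reach_of_probeO hΓ hsep hm hc₀ hV₀ hP he2 (HState.ocand_of_ochoice hc).2 (hsucc du hdu)

/-- **The anchored exploration process is lawful**, given (32) at the root cell (`hQ0`) and the failure bound (33) after valid histories
(`hfail`, at the source anchor replayed from the history). [cite: KozmaNitzan2024, §4 pp. 25–31] -/
theorem lawfulO {ε : ℝ}
    (hQ0 : ∀ du : MDir, du.2 = qNE du.1 → 1 - S.δc < (prodBernoulli (pinW (KNLevels.lattW G S.p) ↑(S.U₀ G) ↑(S.U₀ G))).real
      (⋃ t ∈ (↑(S.Γ.M S.Γ.a₀ ((0 : Site 2) + stepVec du)) : Set V),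
        openConnIn (↑(S.Γ.Q S.Γ.a₀ 0 ∪ S.Γ.Ewv S.Γ.a₀ 0 du) : Set V) S.Γ.root t))
    (hfail : ∀ h e, S.ValidO G h e →
      (bondPercolation G S.p).real {ω | ¬S.succAO G h e (S.aOfO G h e) ((S.probeO G h e (S.aOfO G h e)).read ω)} ≤ ε) :
    (S.schemeO G).OLawful qNE G S.p ε where
  fresh := by
    intro h P hP
    obtain ⟨e, -, -, rfl⟩ := S.nextProbe_eq_someO hP
    constructor
    · rw [Set.disjoint_left]
      intro x hx hxU
      exact (Finset.mem_sdiff.1 (Finset.mem_coe.1 hx)).2 (S.U₀_subset_F _ (Finset.mem_coe.1 hxU))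
    · rw [Finset.disjoint_left]
      intro x hx hxs
      exact (Finset.mem_sdiff.1 hx).2 (Finset.mem_union_right _ hxs)
  probes := by
    intro ω _ n hc
    obtain ⟨e, he⟩ := Option.ne_none_iff_exists'.1 hc
    have hV : S.ValidO G (S.hstO G ω n) e := valid_of_choiceO hΓ hsep hQ0 he
    have he' : (S.astOfO G (S.hstO G ω n)).st.ochoice qNE = some e := by rw [← S.stN_eqO]; exact he
    show S.nextProbeO G (S.hstO G ω n) ≠ none
    rw [S.nextProbe_of_validO he' hV]
    exact Option.some_ne_none _
  fail := by
    intro h P e hP hc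
    obtain ⟨e', hc', hV, rfl⟩ := S.nextProbe_eq_someO hP
    have hc'' : (S.astOfO G h).st.ochoice qNE = some e := by rw [← S.scheme_mstO]; exact hc
    have hcc : some e' = some e := hc'.symm.trans hc''
    cases Option.some_injective _ hcc
    exact hfail h _ hV

end KSchA

end KNCells

end Transplant

end Summit.CriticalPhenomena.PercolationContinuityZ3.Theorems

end
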